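import Mathlib.MeasureTheory.Measure.HasOuterApproxClosed
import Literature.Analysis.FunctionSpaces.TorusTrigPoly
import Literature.Analysis.FunctionSpaces.TorusHeatSmoothing
import Literature.Analysis.FluidPDE.LagrangianLatticeCarrier
import Summits.AnomalousDissipation.AnomalousDissipation.Theorems.SolenoidalFractalHomogenisationPermissibleFractalCarrierLayers
import HarnessLib

/-!
# Transvections of the flat torus are measure preserving; the slot shear maps of lattice words

Helper file for the Lagrangian cone of route `SolenoidalFractalHomogenisation` (cruxes K3L
`LagrangianCarrierConstruction`, stmt-AnomalousDissipation-24913, stubs `stub_flowsL` / `stub_regularL`; K1L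
`LagrangianRenormalisationStep`, stmt-AnomalousDissipation-24912, interface clause `LevelRegular` of planner ruling R22-1):
Armstrong–Vicol's Lagrangian flows `X_m` (arXiv:2305.05048 §2.2) of lattice shear words are, window by window, finite
compositions of the SLOT SHEAR MAPS `LatticePhase.shearMap P n d : x ↦ x + proj ((d/n) • P.layer (n • x))`
(`Literature/Analysis/FluidPDE/LagrangianLatticeCarrier.lean`).  This file proves the measure-theoretic facts about them
that every construction / regularity argument needs, in a design-independent form:

* **Transvections are measure preserving** (`measurePreserving_transvection`): for a measurable `G : 𝕋ᵈ → ℝ` that is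
  invariant along the line `ℝv` (`G (x + proj (s • v)) = G x`), the map `S x = x + proj (G x • v)` preserves the Haar
  volume.  Proof by characters, with no Fourier expansion of `G`: `e_k (S x) = e_k x · 𝐞(G x ⟪v, k⟫)`; if `⟪v,k⟫ = 0` the
  integrand is `e_k`; otherwise the Haar translation by `x₀ = proj (v / (2⟪v,k⟫))` fixes `G` and multiplies `e_k` by
  `𝐞(1/2) = -1`, so `∫ e_k ∘ S = -∫ e_k ∘ S = 0 = ∫ e_k` (`integral_mFourier_comp_transvection`); density of trigonometric
  polynomials (`UnitAddTorus.span_mFourier_closure_eq_top`) and `ext_of_forall_integral_eq_of_IsFiniteMeasure` finish.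
* **Slot shears**: `shearMap P n d` is the transvection with `v = P.e`, `G x = (d/n)·(layer amplitude at n • x)`, invariant
  along `ℝ P.e` because `P.e ⊥ m` (`layer_add_proj_smul_e`); hence measure preserving (`measurePreserving_shearMap`), with
  the group law `shearMap P n d₁ ∘ shearMap P n d₂ = shearMap P n (d₁ + d₂)` (`shearMap_shearMap`) and inverse
  `shearMap P n (-d)`.

No definitions, no named facts, no sorry; rung-leaf bookkeeping only.  Prover seat `ad-solenoidal-k2r-lowerlaw-p1` g5, 2026-08-28.
-/

set_option linter.dupNamespace false

noncomputable section

namespace Summit.AnomalousDissipation.AnomalousDissipation.Theorems.SolenoidalFractalHomogenisation.LagrangianCarrier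

open Set Filter Topology MeasureTheory Function
open scoped InnerProductSpace ENNReal NNReal Real FourierTransform
open Literature.Analysis Literature.Analysis.FunctionSpaces Literature.Analysis.FunctionSpaces.Torus
open Literature.Analysis.FluidPDE Literature.Analysis.FluidPDE.LatticeShear
open UnitAddTorus

section Transvection

variable {d : Type*} [Fintype d]

/-- A transvection `x ↦ x + proj (G x • v)` with measurable amplitude `G` is measurable. [folklore] -/
theorem measurable_transvection {G : UnitAddTorus d → ℝ} (hG : Measurable G) (v : EuclideanSpace ℝ d) :
    Measurable fun x : UnitAddTorus d => x + proj (G x • v) :=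
  measurable_id.add (measurable_proj.comp (hG.smul_const v))

/-- A character along a transvection: `e_k (x + proj (G x • v)) = e_k x · 𝐞 (G x · ⟪v, k⟫)`. [folklore] -/
theorem mFourier_transvection [DecidableEq d] (G : UnitAddTorus d → ℝ) (v : EuclideanSpace ℝ d) (k : d → ℤ) (x : UnitAddTorus d) :
    mFourier k (x + proj (G x • v)) = mFourier k x * (𝐞 (G x * ⟪v, latticeVec k⟫_ℝ) : ℂ) := by
  rw [mFourier_apply_add, mFourier_proj_eq_fourierChar, real_inner_smul_left]

/-- **Characters integrate the same along a transvection**: for `G` measurable and invariant along `ℝv`,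
`∫ e_k (x + proj (G x • v)) dx = ∫ e_k = δ_{k0}`. [folklore] -/
theorem integral_mFourier_comp_transvection [DecidableEq d] {G : UnitAddTorus d → ℝ} {v : EuclideanSpace ℝ d}
    (hinv : ∀ (s : ℝ) (x : UnitAddTorus d), G (x + proj (s • v)) = G x) (k : d → ℤ) :
    ∫ x, mFourier k (x + proj (G x • v)) = ∫ x, mFourier k x := by
  set c : ℝ := ⟪v, latticeVec k⟫_ℝ with hc_def
  simp_rw [mFourier_transvection]
  by_cases hc : c = 0
  · simp [← hc_def, hc]
  · -- the Haar translation by `x₀ = proj ((1/(2c)) • v)` fixes `G` and multiplies `e_k` by `𝐞(1/2) = -1`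
    set x₀ : UnitAddTorus d := proj ((1 / (2 * c)) • v) with hx₀
    set I : ℂ := ∫ x, mFourier k x * (𝐞 (G x * c) : ℂ) with hI
    have hk0 : mFourier k x₀ = -1 := by
      rw [hx₀, mFourier_proj_eq_fourierChar, real_inner_smul_left, ← hc_def,
        show 1 / (2 * c) * c = 1 / 2 by field_simp, Real.fourierChar_apply]
      have : (((2 * Real.pi * (1 / 2) : ℝ)) : ℂ) * Complex.I = Real.pi * Complex.I := by push_cast; ring
      rw [this, Complex.exp_pi_mul_I]
    have htrans : I = mFourier k x₀ * I := by
      have hshift := integral_add_right_eq_self (μ := (volume : Measure (UnitAddTorus d)))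
        (fun x => mFourier k x * (𝐞 (G x * c) : ℂ)) x₀
      calc I = ∫ x, mFourier k (x + x₀) * (𝐞 (G (x + x₀) * c) : ℂ) := by rw [hI]; exact hshift.symm
        _ = ∫ x, mFourier k x₀ * (mFourier k x * (𝐞 (G x * c) : ℂ)) := by
            refine integral_congr_ae (ae_of_all _ fun x => ?_)
            have hGx : G (x + x₀) = G x := by rw [hx₀]; exact hinv _ _
            dsimp only
            rw [mFourier_apply_add, hGx]
            ring
        _ = mFourier k x₀ * I := by rw [integral_const_mul, hI]
    rw [hk0, neg_one_mul] at htrans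
    have hI0 : I = 0 := by
      have : (2 : ℂ) * I = 0 := by linear_combination htrans
      simpa using this
    have hk : k ≠ 0 := by
      rintro rfl
      apply hc
      rw [hc_def, latticeVec_zero, inner_zero_right]
    rw [hI0, integral_mFourier, if_neg hk]

/-- A continuous function along a measurable self-map of the torus is integrable (finite volume). [folklore] -/
theorem integrable_continuousMap_comp {S : UnitAddTorus d → UnitAddTorus d} (hS : Measurable S)
    (φ : C(UnitAddTorus d, ℂ)) : Integrable (fun x => φ (S x)) volume :=
  Integrable.mono' (integrable_const ‖φ‖) ((φ.continuous.measurable.comp hS).aestronglyMeasurable)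
    (ae_of_all _ fun x => φ.norm_coe_le_norm (S x))

/-- A continuous function on the torus is integrable (finite volume). [folklore] -/
theorem integrable_continuousMap (φ : C(UnitAddTorus d, ℂ)) : Integrable (fun x => φ x) volume := by
  simpa using integrable_continuousMap_comp measurable_id φ

/-- **Continuous functions integrate the same along a transvection** (density of trigonometric polynomials,
`UnitAddTorus.span_mFourier_closure_eq_top`). [folklore] -/
theorem integral_continuousMap_comp_transvection [DecidableEq d] {G : UnitAddTorus d → ℝ} (hG : Measurable G)
    {v : EuclideanSpace ℝ d} (hinv : ∀ (s : ℝ) (x : UnitAddTorus d), G (x + proj (s • v)) = G x)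
    (φ : C(UnitAddTorus d, ℂ)) :
    ∫ x, φ (x + proj (G x • v)) = ∫ x, φ x := by
  have hS := measurable_transvection hG v
  -- on the span of the characters
  have hspan : ∀ ψ ∈ Submodule.span ℂ (Set.range (mFourier (d := d))),
      ∫ x, ψ (x + proj (G x • v)) = ∫ x, ψ x := by
    intro ψ hψ
    induction hψ using Submodule.span_induction with
    | mem ψ hψ =>
        obtain ⟨n, rfl⟩ := hψ
        exact integral_mFourier_comp_transvection hinv n
    | zero => simp
    | add ψ₁ ψ₂ _ _ h1 h2 =>
        simp only [ContinuousMap.add_apply]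
        rw [integral_add (integrable_continuousMap_comp hS ψ₁) (integrable_continuousMap_comp hS ψ₂),
          integral_add (integrable_continuousMap ψ₁) (integrable_continuousMap ψ₂), h1, h2]
    | smul a ψ _ h1 =>
        simp only [ContinuousMap.smul_apply, smul_eq_mul]
        rw [integral_const_mul, integral_const_mul, h1]
  -- both sides are `1`-Lipschitz in the sup norm
  have hlip : ∀ {S : UnitAddTorus d → UnitAddTorus d}, Measurable S →
      Continuous fun ψ : C(UnitAddTorus d, ℂ) => ∫ x, ψ (S x) := by
    intro S hS'
    refine (LipschitzWith.of_dist_le_mul (K := 1) fun ψ₁ ψ₂ => ?_).continuous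
    rw [dist_eq_norm, dist_eq_norm, NNReal.coe_one, one_mul,
      ← integral_sub (integrable_continuousMap_comp hS' ψ₁) (integrable_continuousMap_comp hS' ψ₂)]
    calc ‖∫ x, (ψ₁ (S x) - ψ₂ (S x))‖ ≤ ∫ _x, ‖ψ₁ - ψ₂‖ ∂(volume : Measure (UnitAddTorus d)) :=
          norm_integral_le_of_norm_le (integrable_const _) (ae_of_all _ fun x => by
            simpa using (ψ₁ - ψ₂).norm_coe_le_norm (S x))
      _ = ‖ψ₁ - ψ₂‖ := by simp
  have hdense : Dense (Submodule.span ℂ (Set.range (mFourier (d := d))) : Set C(UnitAddTorus d, ℂ)) :=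
    Submodule.dense_iff_topologicalClosure_eq_top.2 UnitAddTorus.span_mFourier_closure_eq_top
  exact closure_minimal (fun ψ hψ => hspan ψ hψ) (isClosed_eq (hlip hS) (hlip measurable_id)) (hdense φ)

/-- **Transvections of the torus are measure preserving**: for `G : 𝕋ᵈ → ℝ` measurable and invariant along the line
`ℝv`, the map `x ↦ x + proj (G x • v)` preserves the Haar volume (Armstrong–Vicol's «the flows are volume preserving»,
arXiv:2305.05048 §2.2, in the form needed for lattice shear layers). [folklore] -/
theorem measurePreserving_transvection [DecidableEq d] {G : UnitAddTorus d → ℝ} (hG : Measurable G) {v : EuclideanSpace ℝ d}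
    (hinv : ∀ (s : ℝ) (x : UnitAddTorus d), G (x + proj (s • v)) = G x) :
    MeasurePreserving (fun x : UnitAddTorus d => x + proj (G x • v)) volume volume := by
  have hS := measurable_transvection hG v
  refine ⟨hS, ?_⟩
  haveI : IsFiniteMeasure (Measure.map (fun x : UnitAddTorus d => x + proj (G x • v)) volume) :=
    Measure.isFiniteMeasure_map volume _
  refine ext_of_forall_integral_eq_of_IsFiniteMeasure fun f => ?_
  rw [integral_map hS.aemeasurable f.continuous.aestronglyMeasurable]
  -- pass through the complexification of `f`
  set φ : C(UnitAddTorus d, ℂ) := ⟨fun x => ((f x : ℝ) : ℂ), by fun_prop⟩ with hφ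
  have h := integral_continuousMap_comp_transvection hG hinv φ
  simp only [hφ, ContinuousMap.coe_mk] at h
  rw [integral_complex_ofReal, integral_complex_ofReal] at h
  exact_mod_cast h

end Transvection

section SlotShear

open Summit.AnomalousDissipation.AnomalousDissipation.Theorems.SolenoidalFractalHomogenisation.PermissibleCarrier
  (layer_nsmul_eq isSmooth_layer_nsmul)

/-- The frequency of a rescaled layer: `latticeVec (n m) = n • latticeVec m`. [folklore] -/
theorem latticeVec_mul_natCast (m : Fin 3 → ℤ) (n : ℕ) :
    latticeVec (fun i => m i * n) = (n : ℝ) • latticeVec m := by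
  ext i
  simp [latticeVec_apply, mul_comm]

/-- The rescaled character of a phase is invariant along the polarisation line `ℝ ê` (`ê ⊥ m`). [folklore] -/
theorem mFourier_mul_natCast_add_proj_smul_e (P : LatticePhase) (n : ℕ) (s : ℝ) (x : UnitAddTorus (Fin 3)) :
    mFourier (fun i => P.m i * n) (x + proj (s • P.e)) = mFourier (fun i => P.m i * n) x := by
  rw [mFourier_apply_add, mFourier_proj_eq_fourierChar, latticeVec_mul_natCast, real_inner_smul_left,
    real_inner_smul_right, P.e_perp, mul_zero, mul_zero, Real.fourierChar_apply]
  simp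

/-- The rescaled layer is invariant along its own polarisation line: `layer (n • (x + proj (s • ê))) = layer (n • x)`
(the shear moves points along `ê ⊥ m`, and the layer depends on `x` only through `m • x`). [cite: MeshalkinSinai1961, pp. 1700–1705 (Kolmogorov shear layer)] -/
theorem layer_nsmul_add_proj_smul_e (P : LatticePhase) (n : ℕ) (s : ℝ) (x : UnitAddTorus (Fin 3)) :
    P.layer (n • (x + proj (s • P.e))) = P.layer (n • x) := by
  rw [layer_nsmul_eq, layer_nsmul_eq, mFourier_mul_natCast_add_proj_smul_e]

/-- The slot shear map as a transvection along `ê` with the scalar amplitude `(d/n)·Im(e_{nm}(x) e^{iφ})/(2π|m|)`.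
[cite: ArmstrongVicol2025, §2.2 (PDF p. 18: the flows X_m)] -/
theorem shearMap_eq_transvection (P : LatticePhase) (n : ℕ) (d : ℝ) :
    P.shearMap n d = fun x => x + proj ((d / (n : ℝ) *
      ((mFourier (fun i => P.m i * n) x * Complex.exp (P.φ * Complex.I)).im / (2 * Real.pi * ‖latticeVec P.m‖))) • P.e) := by
  funext x
  rw [LatticePhase.shearMap, layer_nsmul_eq, smul_smul]

/-- The amplitude of a slot shear is continuous. [folklore] -/
theorem continuous_shearAmplitude (P : LatticePhase) (n : ℕ) (d : ℝ) :
    Continuous fun x : UnitAddTorus (Fin 3) => d / (n : ℝ) *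
      ((mFourier (fun i => P.m i * n) x * Complex.exp (P.φ * Complex.I)).im / (2 * Real.pi * ‖latticeVec P.m‖)) := by
  refine continuous_const.mul (Continuous.div_const (Complex.continuous_im.comp ?_) _)
  exact ((mFourier (fun i => P.m i * n)).continuous).mul continuous_const

/-- **Slot shear maps are measure preserving** on `𝕋³` (a transvection along `ê ⊥ m`; `measurePreserving_transvection`).
[cite: ArmstrongVicol2025, §2.2 (PDF p. 18: the flows X_m are volume preserving)] -/
theorem measurePreserving_shearMap (P : LatticePhase) (n : ℕ) (d : ℝ) :
    MeasurePreserving (P.shearMap n d) volume volume := by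
  rw [shearMap_eq_transvection]
  refine measurePreserving_transvection (continuous_shearAmplitude P n d).measurable fun s x => ?_
  rw [mFourier_mul_natCast_add_proj_smul_e]

/-- Slot shear maps are continuous. [folklore] -/
theorem continuous_shearMap (P : LatticePhase) (n : ℕ) (d : ℝ) : Continuous (P.shearMap n d) := by
  rw [shearMap_eq_transvection]
  exact continuous_id.add (continuous_proj.comp ((continuous_shearAmplitude P n d).smul continuous_const))

/-- **Group law of the slot shears** in the accumulated slot time: `X(d₁) ∘ X(d₂) = X(d₁ + d₂)` (the layer is invariant
along the shear, so the second shear sees the same layer value). [cite: ArmstrongVicol2025, §2.2 (PDF p. 18: the flows X_m)] -/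
theorem shearMap_shearMap (P : LatticePhase) (n : ℕ) (d₁ d₂ : ℝ) (x : UnitAddTorus (Fin 3)) :
    P.shearMap n d₁ (P.shearMap n d₂ x) = P.shearMap n (d₁ + d₂) x := by
  have hinv : P.layer (n • (x + proj ((d₂ / (n : ℝ)) • P.layer (n • x)))) = P.layer (n • x) := by
    conv_lhs => rw [layer_nsmul_eq P n x, smul_smul]
    exact layer_nsmul_add_proj_smul_e P n _ x
  simp only [LatticePhase.shearMap]
  rw [hinv, add_assoc, ← proj_add, ← add_smul, ← add_div, add_comm d₂ d₁]

/-- The slot shear with the opposite slot time is the inverse map. [cite: ArmstrongVicol2025, §2.2 (PDF p. 18: X_m(s,x,s) = x)] -/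
theorem shearMap_neg_shearMap (P : LatticePhase) (n : ℕ) (d : ℝ) (x : UnitAddTorus (Fin 3)) :
    P.shearMap n (-d) (P.shearMap n d x) = x := by
  rw [shearMap_shearMap, neg_add_cancel, LatticePhase.shearMap_zero]

/-- … and on the other side. [cite: ArmstrongVicol2025, §2.2 (PDF p. 18: X_m(s,x,s) = x)] -/
theorem shearMap_shearMap_neg (P : LatticePhase) (n : ℕ) (d : ℝ) (x : UnitAddTorus (Fin 3)) :
    P.shearMap n d (P.shearMap n (-d) x) = x := by
  rw [shearMap_shearMap, add_neg_cancel, LatticePhase.shearMap_zero]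

/-- Slot shear maps are bijections of the torus. [folklore] -/
theorem bijective_shearMap (P : LatticePhase) (n : ℕ) (d : ℝ) : Function.Bijective (P.shearMap n d) :=
  Function.bijective_iff_has_inverse.2 ⟨P.shearMap n (-d), shearMap_neg_shearMap P n d, shearMap_shearMap_neg P n d⟩


/-- **Change of variables along a slot shear**: `∫ f (X x) dx = ∫ f` for every `f` (measure preservation along the measurable
equivalence `X(d)`, `X(-d)`; no integrability needed). [folklore] -/
theorem integral_comp_shearMap {E : Type*} [NormedAddCommGroup E] [NormedSpace ℝ E] (P : LatticePhase) (n : ℕ) (d : ℝ)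
    (f : UnitAddTorus (Fin 3) → E) : ∫ x, f (P.shearMap n d x) = ∫ x, f x := by
  let e : UnitAddTorus (Fin 3) ≃ᵐ UnitAddTorus (Fin 3) :=
    { toFun := P.shearMap n d
      invFun := P.shearMap n (-d)
      left_inv := shearMap_neg_shearMap P n d
      right_inv := shearMap_shearMap_neg P n d
      measurable_toFun := (continuous_shearMap P n d).measurable
      measurable_invFun := (continuous_shearMap P n (-d)).measurable }
  exact (measurePreserving_shearMap P n d).integral_comp e.measurableEmbedding f

/-- The lift of a composition with a slot shear: `lift (g ∘ X) = lift g ∘ (y ↦ y + (d/n) • lift(layer ∘ (n • ·)) y)`. [folklore] -/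
theorem lift_comp_shearMap {F : Type*} (P : LatticePhase) (n : ℕ) (d : ℝ) (g : UnitAddTorus (Fin 3) → F) :
    lift (g ∘ P.shearMap n d) = lift g ∘ fun y => y + (d / (n : ℝ)) • lift (fun x => P.layer (n • x)) y := by
  funext y
  simp only [lift_apply, Function.comp_apply, LatticePhase.shearMap, proj_add]

/-- **Composition with a slot shear preserves smoothness**: `g` smooth on `𝕋³` ⇒ `g ∘ X(d)` smooth (the lifted shear
`y ↦ y + (d/n)·layer(n·proj y)` is `C^∞` since the rescaled layer is). [folklore] -/
theorem isSmooth_comp_shearMap {F : Type*} [NormedAddCommGroup F] [NormedSpace ℝ F] {g : UnitAddTorus (Fin 3) → F}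
    (hg : IsSmooth g) (P : LatticePhase) (n : ℕ) (d : ℝ) : IsSmooth (g ∘ P.shearMap n d) := by
  change ContDiff ℝ ((⊤ : ℕ∞) : WithTop ℕ∞) (lift (g ∘ P.shearMap n d))
  rw [lift_comp_shearMap]
  have hl : ContDiff ℝ ((⊤ : ℕ∞) : WithTop ℕ∞) (lift (fun x => P.layer (n • x))) := isSmooth_layer_nsmul P n
  exact hg.comp (contDiff_id.add (hl.const_smul (d / (n : ℝ))))

end SlotShear

end Summit.AnomalousDissipation.AnomalousDissipation.Theorems.SolenoidalFractalHomogenisation.LagrangianCarrier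

end
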